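import Summits.HubbardSuperconductivity.HubbardSuperconductivity.Theorems.AnisotropyChordTransferFibre3FinXBEval
import Summits.HubbardSuperconductivity.HubbardSuperconductivity.Theorems.AnisotropyChordTransferFibre3FinXBKit

/-!
# Route `AnisotropyChord` / H0 rotor rung: FIN small-`L` EXACT-BLOCK evaluator — soundness of the scalars, the per-momentum
values and the discs of `φ̂_e(k)`

Soundness layer 1 of `…Fibre3FinXBEval` (the certificate itself is `…Fibre3FinXBCert`): for the ground two-magnon profile
`(λ₂, f)` at `0 ≤ Δ < 1` with `λ₂·D` in the cell `[la, lb]` passing g4's `groundCellCheck` and `xbScalOK`,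
* helpers: `mem_isqP`, `mem_isqrt` (integer square roots), `mem_ipt`, `sin_mod`, `sin_eq_cos_shift`;
* ★ `scal_sound` — every field of `xbScal` encloses its real scalar (`λ₂, c_s, a = Δf(x̂), Δ, f(x̂), d, q, F₂(0), τ̄, γ, ε₁`;
  g4 `mem_groundCs_cell`/`mem_deltaMulFnn_cell`/`mem_delta_cell`, p1 `ground_delta_eq`/`ground_fnn_eq_explicit`,
  p2 `sNormNamed_holds`, `mem_torSum_cell`);
* ★ `mem_tTab` (`T(k) = Σ_p g(p)g(p − k)`), `mem_tAt` (`t(k)`, `tfun_eq_conv`), `mem_fAt` (`F₂(k)`, p2 `f2ClosedPlusTail_holds`),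
  `mem_betaAt`;
* `eDir` (the four directions in the order of `nnList_map_sum`), `phase_dir_re/im`, `mem_cosAt`, `mem_sinAt`,
  ★ `disc_sound` — `DiscOK (φ̂_e(k)) (disc …)`: a centre/radius witness with the three enclosures
  (`phiHat_near_mC`, `phiHat_zero_eq`, `mC_re`, `mC_im`), and the two consumers ★ `mem_n2Of` (`|φ̂|²`), ★ `mem_crossOf`
  (`Re(conj φ̂ φ̂′)`, p2 `blockCrossTerm_holds`).
Prover seat `hubbard-h0-rotor-p3` g5; helper for piece A = stmt-HubbardSuperconductivity-23918 of rung 19089 (`--supports`, helper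
class).  WHAT THIS IS NOT: nothing here proves superconductivity in the Hubbard model (rotor TARGET as worded stays FALSE, g15 verdict);
soundness lemmas for the FIN certificates of ONE conditional reduction.  Tree imports only; no sorry, no new axioms.
-/

set_option linter.dupNamespace false
set_option autoImplicit false

namespace Summit.HubbardSuperconductivity.HubbardSuperconductivity.Theorems.AnisotropyChord.Transfer.Fibre3

namespace FinXB

open scoped BigOperators
open Finset Hole2 FinCell

/-! ## Interval helpers -/

/-- squares with the clamp. [folklore] -/
theorem mem_isqP {x : ℝ} {I : Iv} (hx : mem x I) : mem (x ^ 2) (isqP I) := by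
  have h := mem_imul hx hx
  rw [← sq] at h
  obtain ⟨h1, h2⟩ := h
  unfold isqP mem
  refine ⟨?_, h2⟩
  have hx2 : 0 ≤ x ^ 2 * ((D : ℤ) : ℝ) := mul_nonneg (sq_nonneg _) D_pos.le
  have : (((max (imul I I).1 0 : ℤ)) : ℝ) = max (((imul I I).1 : ℤ) : ℝ) 0 := by push_cast; rfl
  rw [this]
  exact max_le h1 hx2

/-- exact endpoints. [folklore] -/
theorem mem_ipt (z : ℤ) : mem ((z : ℝ) / ((D : ℤ) : ℝ)) (ipt z) := mem_exact z

/-- the value of an exact endpoint times `D`. [folklore] -/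
theorem ipt_val (z : ℤ) : (z : ℝ) / ((D : ℤ) : ℝ) * ((D : ℤ) : ℝ) = z := div_mul_cancel₀ _ (ne_of_gt D_pos)

/-- `D.toNat = D` as reals. [folklore] -/
theorem D_toNat_cast : ((D.toNat : ℕ) : ℝ) = ((D : ℤ) : ℝ) := by
  have h : 0 ≤ D := le_of_lt D_pos_int
  exact_mod_cast Int.toNat_of_nonneg h

/-- a clamped end as a real. [folklore] -/
theorem max_toNat_cast (z : ℤ) : (((max z 0).toNat : ℕ) : ℝ) = max (z : ℝ) 0 := by
  have h : 0 ≤ max z 0 := le_max_right _ _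
  have := Int.toNat_of_nonneg h
  have e : (((max z 0).toNat : ℕ) : ℤ) = max z 0 := this
  have : (((max z 0).toNat : ℕ) : ℝ) = ((max z 0 : ℤ) : ℝ) := by exact_mod_cast e
  rw [this]; push_cast; rfl

/-- ★ integer square roots enclose `√`: `0 ≤ y`, `y² ∈ J` ⇒ `y ∈ isqrt J`. [folklore] -/
theorem mem_isqrt {y : ℝ} (hy : 0 ≤ y) {J : Iv} (h : mem (y ^ 2) J) : mem y (isqrt J) := by
  obtain ⟨h1, h2⟩ := h
  have hD := D_pos
  unfold isqrt mem
  set n1 : ℕ := (max J.1 0).toNat * D.toNat with hn1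
  set n2 : ℕ := (max J.2 0).toNat * D.toNat with hn2
  have hyD : 0 ≤ y * ((D : ℤ) : ℝ) := mul_nonneg hy hD.le
  have hsq : (y * ((D : ℤ) : ℝ)) ^ 2 = y ^ 2 * ((D : ℤ) : ℝ) * ((D : ℤ) : ℝ) := by ring
  have hn1R : (n1 : ℝ) = max ((J.1 : ℤ) : ℝ) 0 * ((D : ℤ) : ℝ) := by
    rw [hn1]; push_cast; rw [max_toNat_cast, D_toNat_cast]
  have hn2R : (n2 : ℝ) = max ((J.2 : ℤ) : ℝ) 0 * ((D : ℤ) : ℝ) := by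
    rw [hn2]; push_cast; rw [max_toNat_cast, D_toNat_cast]
  have hlo : (n1 : ℝ) ≤ (y * ((D : ℤ) : ℝ)) ^ 2 := by
    rw [hn1R, hsq]
    have : max ((J.1 : ℤ) : ℝ) 0 ≤ y ^ 2 * ((D : ℤ) : ℝ) := max_le h1 (by positivity)
    nlinarith
  have hhi : (y * ((D : ℤ) : ℝ)) ^ 2 ≤ (n2 : ℝ) := by
    rw [hn2R, hsq]
    have : y ^ 2 * ((D : ℤ) : ℝ) ≤ max ((J.2 : ℤ) : ℝ) 0 := h2.trans (le_max_left _ _)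
    nlinarith
  clear_value n1 n2
  constructor
  · -- `Nat.sqrt n1 ≤ y·D`
    have hs' : Nat.sqrt n1 ^ 2 ≤ n1 := Nat.sqrt_le' n1
    have hs : ((Nat.sqrt n1 : ℕ) : ℝ) ^ 2 ≤ (n1 : ℝ) := by exact_mod_cast hs'
    have hs0 : (0 : ℝ) ≤ ((Nat.sqrt n1 : ℕ) : ℝ) := by positivity
    have : ((Nat.sqrt n1 : ℕ) : ℝ) ≤ y * ((D : ℤ) : ℝ) := by
      by_contra hc
      push Not at hc
      nlinarith
    exact_mod_cast this
  · -- `y·D ≤ Nat.sqrt n2 + 1`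
    have hs' : n2 < (Nat.sqrt n2 + 1) ^ 2 := Nat.lt_succ_sqrt' n2
    have hs : (n2 : ℝ) < (((Nat.sqrt n2 : ℕ) : ℝ) + 1) ^ 2 := by exact_mod_cast hs'
    have hs0 : (0 : ℝ) ≤ ((Nat.sqrt n2 : ℕ) : ℝ) + 1 := by positivity
    have : y * ((D : ℤ) : ℝ) ≤ ((Nat.sqrt n2 : ℕ) : ℝ) + 1 := by
      by_contra hc
      push Not at hc
      nlinarith
    push_cast
    exact this

/-- `sin(2πn/L) = sin(2π(n mod L)/L)`. [folklore] -/
theorem sin_mod (L : ℕ) (hL : 0 < L) (n : ℕ) :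
    Real.sin (2 * Real.pi * n / L) = Real.sin (2 * Real.pi * ((n % L : ℕ) : ℝ) / L) := by
  have hLr : (L : ℝ) ≠ 0 := by exact_mod_cast (ne_of_gt hL)
  conv_lhs => rw [← Nat.mod_add_div n L]
  rw [show 2 * Real.pi * ((n % L + L * (n / L) : ℕ) : ℝ) / L
      = 2 * Real.pi * ((n % L : ℕ) : ℝ) / L + ((n / L : ℕ) : ℝ) * (2 * Real.pi) by
    push_cast; field_simp]
  exact Real.sin_add_nat_mul_two_pi _ _

/-- `sin(2πm/L) = cos(2π(4m + 3L)/(4L))`. [folklore] -/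
theorem sin_eq_cos_shift (L : ℕ) (hL : 0 < L) (m : ℕ) :
    Real.sin (2 * Real.pi * m / L) = Real.cos (2 * Real.pi * ((4 * m + 3 * L : ℕ) : ℝ) / ((4 * L : ℕ) : ℝ)) := by
  have hLr : (L : ℝ) ≠ 0 := by exact_mod_cast (ne_of_gt hL)
  have e : 2 * Real.pi * ((4 * m + 3 * L : ℕ) : ℝ) / ((4 * L : ℕ) : ℝ)
      = (2 * Real.pi * m / L - Real.pi / 2) + 2 * Real.pi := by
    push_cast; field_simp; ring
  rw [e, Real.cos_add_two_pi, Real.cos_sub_pi_div_two]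

/-! ## Scalars -/

/-- the real scalars behind `xbScal`, field by field. -/
def ScalOK (L : ℕ) [NeZero L] (Δ lam2 : ℝ) (f : Tor L → ℝ) (S : XBScal) : Prop :=
  mem lam2 S.lam ∧ mem (cS L Δ lam2 f) S.cs ∧ mem (Δ * f (K1 L)) S.a ∧ mem Δ S.delta ∧ mem (f (K1 L)) S.fnn ∧
  mem (dPar L Δ f) S.d ∧ mem (qPar L Δ f) S.q ∧ mem (nf2V L Δ f) S.nf2 ∧ mem (tauBar L Δ lam2 f) S.tauBar ∧
  mem (gamPar L Δ lam2 f) S.gam ∧ mem (eps1 L) S.eps1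

/-- ★ the scalars are enclosed (ground profile, `0 ≤ Δ < 1`, `λ₂·D` in a checked cell). [folklore] -/
theorem scal_sound (L : ℕ) [NeZero L] (hL : 5 ≤ L) {Δ lam2 : ℝ} (hΔ0 : 0 ≤ Δ) (hΔ1 : Δ < 1) {f : Tor L → ℝ}
    (hf : IsGroundTwoMagnon L Δ lam2 f) {la lb : ℤ}
    (hla : (la : ℝ) ≤ lam2 * ((D : ℤ) : ℝ)) (hlb : lam2 * ((D : ℤ) : ℝ) ≤ (lb : ℝ))
    (hchk : groundCellCheck L la lb = true) (hsc : xbScalOK L la lb = true) :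
    ScalOK L Δ lam2 f (xbScal L la lb (gresCellTab L (cosTab L) la lb)) := by
  have hL3 : 3 ≤ L := by omega
  obtain ⟨hpos, _, _⟩ := groundCellCheck_spec hchk
  have hlam : 0 < lam2 := lam2_pos L hL3 hΔ1 hf.1
  have hD := D_pos
  have hLpos : (0 : ℝ) < L := by exact_mod_cast (show 0 < L by omega)
  have hV : (0 : ℝ) < (L : ℝ) ^ 2 := by positivity
  -- the explicit profile
  have hΔe : Δ = deltaOfLam L lam2 := ground_delta_eq L hL hΔ0 hΔ1 hf
  have hFe : f (K1 L) = groundFnn L lam2 := ground_fnn_eq_explicit L hL hΔ0 hΔ1 hf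
  -- `λ`
  have mlam : mem lam2 ((la, lb) : Iv) := ⟨hla, hlb⟩
  -- `c_s`
  have mcs : mem (cS L Δ lam2 f) (csIv L la lb) := by
    have h := mem_groundCs_cell L hL3 hlam hla hlb hchk
    have e : groundCs L lam2 = cS L Δ lam2 f := by unfold groundCs cS; rw [← hΔe, ← hFe]
    rwa [e] at h
  -- `a = Δ f(x̂)`
  have ma : mem (Δ * f (K1 L)) (dfnnIv L la lb) := by
    have h := mem_deltaMulFnn_cell L hL3 hlam hla hlb hchk
    rwa [← hΔe, ← hFe] at h
  -- `Δ`
  have mΔ : mem Δ (deltaIv L la lb) := by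
    have h := mem_delta_cell L hL3 hlam hla hlb hchk
    rwa [← hΔe] at h
  -- `f(x̂) = Vλ/(4(1−Δ))`
  have m1Δ : mem (1 - Δ) (isub ione (deltaIv L la lb)) := mem_isub mem_one mΔ
  have m4 : mem (4 * (1 - Δ)) (iscale 4 (isub ione (deltaIv L la lb))) := by
    have := mem_iscale 4 m1Δ; push_cast at this; exact this
  have h4pos : 0 < (iscale 4 (isub ione (deltaIv L la lb))).1 := by
    unfold xbScalOK at hsc; simpa using hsc
  have mfnn : mem (f (K1 L)) (imul (iscale (L * L) ((la, lb) : Iv)) (iinv (iscale 4 (isub ione (deltaIv L la lb))))) := by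
    rw [hFe]
    unfold groundFnn
    rw [← hΔe, div_eq_mul_one_div]
    have hVl : mem ((L : ℝ) ^ 2 * lam2) (iscale (L * L) ((la, lb) : Iv)) := by
      have := mem_iscale (L * L) mlam; push_cast at this; rw [← sq] at this; exact this
    exact mem_imul hVl (mem_iinv m4 h4pos)
  -- `d`, `S₂`, `‖s‖²`
  have md : mem (dPar L Δ f) (imul (dfnnIv L la lb) (dfnnIv L la lb)) := by
    unfold dPar; rw [sq]; exact mem_imul ma ma
  have mS2 : mem (S2n L lam2) (torSumIv L (gresCellTab L (cosTab L) la lb) ![((0 : ℤ), (0 : ℤ))] ![2]) :=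
    mem_torSum_cell L hL3 hla hlb hpos _ _
  have hLL : (0 : ℤ) < ((L * L : ℕ) : ℤ) := by
    have : 0 < L * L := Nat.mul_pos (by omega) (by omega)
    exact_mod_cast this
  have msn : mem (sNormSq L Δ f)
      (idivn (iadd (imul (imul (csIv L la lb) (csIv L la lb)) (torSumIv L (gresCellTab L (cosTab L) la lb)
        ![((0 : ℤ), (0 : ℤ))] ![2])) (imul (dfnnIv L la lb) (dfnnIv L la lb))) ((L * L : ℕ) : ℤ)) := by
    rw [sNormNamed_holds L hL hΔ0 lam2 f hf hlam]
    have h := mem_idivn (mem_iadd (mem_imul (mem_imul mcs mcs) mS2) md) hLL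
    have e : (cS L Δ lam2 f * cS L Δ lam2 f * S2n L lam2 + dPar L Δ f) / (((L * L : ℕ) : ℤ) : ℝ)
        = (cS L Δ lam2 f ^ 2 * S2n L lam2 + dPar L Δ f) / (L : ℝ) ^ 2 := by
      push_cast; ring
    rwa [e] at h
  have moma : mem (1 - Δ * f (K1 L)) (isub ione (dfnnIv L la lb)) := mem_isub mem_one ma
  have mnf2 : mem (nf2V L Δ f) (iadd (iconst (((L * L : ℕ) : ℤ) + 1))
      (isub (idivn (iadd (imul (imul (csIv L la lb) (csIv L la lb)) (torSumIv L (gresCellTab L (cosTab L) la lb)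
        ![((0 : ℤ), (0 : ℤ))] ![2])) (imul (dfnnIv L la lb) (dfnnIv L la lb))) ((L * L : ℕ) : ℤ))
        (imul (isub ione (dfnnIv L la lb)) (isub ione (dfnnIv L la lb))))) := by
    have h := mem_iadd (mem_iconst (((L * L : ℕ) : ℤ) + 1)) (mem_isub msn (mem_imul moma moma))
    have e : ((((L * L : ℕ) : ℤ) + 1 : ℤ) : ℝ) + (sNormSq L Δ f - (1 - Δ * f (K1 L)) * (1 - Δ * f (K1 L)))
        = nf2V L Δ f := by
      unfold nf2V aPar; push_cast; ring
    rwa [e] at h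
  -- `η`, `τ̄`
  have h4 : (0 : ℤ) < 4 := by norm_num
  have mEta : mem (etaEff L lam2) (idivn (iscale (L * L) ((la, lb) : Iv)) 4) := by
    have hVl : mem ((L : ℝ) ^ 2 * lam2) (iscale (L * L) ((la, lb) : Iv)) := by
      have := mem_iscale (L * L) mlam; push_cast at this; rw [← sq] at this; exact this
    have h := mem_idivn hVl h4
    unfold etaEff
    have e : (L : ℝ) ^ 2 * lam2 / ((4 : ℤ) : ℝ) = (L : ℝ) ^ 2 * lam2 / 4 := by push_cast; ring
    rwa [e] at h
  -- assemble
  unfold ScalOK xbScal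
  refine ⟨mlam, mcs, ma, mΔ, mfnn, md, ?_, mnf2, ?_, ?_, ?_⟩
  · -- `q = a f(x̂) (2 − Δ)`
    have h := mem_imul (mem_imul ma mfnn) (mem_isub (mem_iconst 2) mΔ)
    have e : Δ * f (K1 L) * f (K1 L) * (((2 : ℤ) : ℝ) - Δ) = qPar L Δ f := by unfold qPar; push_cast; ring
    rwa [e] at h
  · -- `τ̄`
    have hin := mem_idivn (mem_isub (mem_iadd mem_one msn) (mem_imul moma moma)) hLL
    have h := mem_iscale 2 (mem_imul mEta (mem_iadd moma hin))
    have e : ((2 : ℕ) : ℝ) * (etaEff L lam2 * (1 - Δ * f (K1 L)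
        + (1 + sNormSq L Δ f - (1 - Δ * f (K1 L)) * (1 - Δ * f (K1 L))) / (((L * L : ℕ) : ℤ) : ℝ)))
        = tauBar L Δ lam2 f := by
      unfold tauBar aPar; push_cast; ring
    rwa [e] at h
  · -- `γ = λ F₂(0)/4 + a f(x̂)`
    have h := mem_iadd (mem_idivn (mem_imul mlam mnf2) h4) (mem_imul ma mfnn)
    have e : lam2 * nf2V L Δ f / ((4 : ℤ) : ℝ) + Δ * f (K1 L) * f (K1 L) = gamPar L Δ lam2 f := by
      unfold gamPar; push_cast; ring
    rwa [e] at h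
  · -- `ε₁ = 1 − cos(2π/L)`
    have h1 : 1 < L := by omega
    have hc := mem_cosIv hL3 h1
    rw [← getIv_cosTab h1] at hc
    have h := mem_isub mem_one hc
    unfold eps1
    have e : 1 - Real.cos (2 * Real.pi * ((1 : ℕ) : ℝ) / L) = 1 - Real.cos (2 * Real.pi / L) := by push_cast; ring_nf
    rwa [e] at h

/-! ## Per-momentum values -/

/-- the difference of two momenta at natural coordinates. [folklore] -/
theorem natPair_sub_natPair (L : ℕ) [NeZero L] (p1 p2 k1 k2 : ℕ) :
    ((((p1 : ℕ) : ZMod L), ((p2 : ℕ) : ZMod L)) : Tor L) - ((((k1 : ℕ) : ZMod L), ((k2 : ℕ) : ZMod L)) : Tor L)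
      = (((modNat L ((p1 : ℤ) - k1) : ℕ) : ZMod L), ((modNat L ((p2 : ℤ) - k2) : ℕ) : ZMod L)) := by
  have hL : 0 < L := Nat.pos_of_ne_zero (NeZero.ne L)
  rw [modNat_cast L hL, modNat_cast L hL]
  refine Prod.ext ?_ ?_ <;> simp

/-- ★ the two-propagator table encloses `T(k) = Σ_p g(p) g(p − k)`. [folklore] -/
theorem mem_tTab (L : ℕ) [NeZero L] (hL : 3 ≤ L) {lam : ℝ} {la lb : ℤ}
    (hla : (la : ℝ) ≤ lam * ((D : ℤ) : ℝ)) (hlb : lam * ((D : ℤ) : ℝ) ≤ (lb : ℝ))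
    (hpos : denCellPos L (cosTab L) la lb = true) {k1 k2 : ℕ} (hk1 : k1 < L) (hk2 : k2 < L) :
    mem (∑ p : Tor L, gres L lam p * gres L lam (p - ((((k1 : ℕ) : ZMod L), ((k2 : ℕ) : ZMod L)) : Tor L)))
      (getF (tTab L (gresCellTab L (cosTab L) la lb)) k1 k2) := by
  have hL0 : 0 < L := by omega
  unfold tTab
  rw [getF_mkTab _ hk1 hk2, sum_tor_range]
  refine mem_psum _ _ L fun p1 hp1 => mem_psum _ _ L fun p2 hp2 => ?_
  rw [natPair_sub_natPair]
  exact mem_imul (mem_gAt L hL hla hlb hpos hp1 hp2) (mem_gAt L hL hla hlb hpos (modNat_lt L hL0 _) (modNat_lt L hL0 _))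

/-- ★ `t(k) ∈ tAt` for `k ≠ 0`. [folklore] -/
theorem mem_tAt (L : ℕ) [NeZero L] (hL : 5 ≤ L) {Δ lam2 : ℝ} (hΔ0 : 0 ≤ Δ) {f : Tor L → ℝ}
    (hf : IsGroundTwoMagnon L Δ lam2 f) {la lb : ℤ}
    (hla : (la : ℝ) ≤ lam2 * ((D : ℤ) : ℝ)) (hlb : lam2 * ((D : ℤ) : ℝ) ≤ (lb : ℝ))
    (hpos : denCellPos L (cosTab L) la lb = true) {S : XBScal} (hS : ScalOK L Δ lam2 f S)
    {k1 k2 : ℕ} (hk1 : k1 < L) (hk2 : k2 < L) (hk : ¬ (k1 = 0 ∧ k2 = 0)) :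
    mem (tfun L Δ f ((((k1 : ℕ) : ZMod L), ((k2 : ℕ) : ZMod L))))
      (tAt L S (gresCellTab L (cosTab L) la lb) (tTab L (gresCellTab L (cosTab L) la lb)) k1 k2) := by
  have hL3 : 3 ≤ L := by omega
  obtain ⟨_, mcs, ma, -⟩ := hS
  have hkne : ((((k1 : ℕ) : ZMod L), ((k2 : ℕ) : ZMod L)) : Tor L) ≠ 0 := by
    rw [Ne, Prod.mk_eq_zero, natCast_zmod_eq_zero L hk1, natCast_zmod_eq_zero L hk2]; exact hk
  rw [tfun_eq_conv L hL hΔ0 hf hkne]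
  unfold tAt
  have hLL : (0 : ℤ) < (L : ℤ) * L := by
    have : (0 : ℤ) < L := by exact_mod_cast (show 0 < L by omega)
    positivity
  have h := mem_idivn (mem_isub (mem_imul (mem_imul mcs mcs) (mem_tTab L hL3 hla hlb hpos hk1 hk2))
    (by
      have := mem_iscale 2 (mem_imul (mem_imul ma mcs) (mem_gAt L hL3 hla hlb hpos hk1 hk2))
      exact this)) hLL
  have e : (cS L Δ lam2 f * cS L Δ lam2 f
        * (∑ p : Tor L, gres L lam2 p * gres L lam2 (p - ((((k1 : ℕ) : ZMod L), ((k2 : ℕ) : ZMod L)) : Tor L)))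
        - ((2 : ℕ) : ℝ) * (Δ * f (K1 L) * cS L Δ lam2 f * gres L lam2 ((((k1 : ℕ) : ZMod L), ((k2 : ℕ) : ZMod L)))))
        / ((((L : ℤ) * L : ℤ)) : ℝ)
      = (cS L Δ lam2 f ^ 2
          * (∑ p : Tor L, gres L lam2 p * gres L lam2 (p - ((((k1 : ℕ) : ZMod L), ((k2 : ℕ) : ZMod L)) : Tor L)))
          - 2 * (Δ * f (K1 L)) * cS L Δ lam2 f * gres L lam2 ((((k1 : ℕ) : ZMod L), ((k2 : ℕ) : ZMod L))))
        / (L : ℝ) ^ 2 := by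
    push_cast; ring
  rwa [e] at h

/-- ★ `F₂(k) ∈ fAt` for every `k`. [folklore] -/
theorem mem_fAt (L : ℕ) [NeZero L] (hL : 5 ≤ L) {Δ lam2 : ℝ} (hΔ0 : 0 ≤ Δ) {f : Tor L → ℝ}
    (hf : IsGroundTwoMagnon L Δ lam2 f) {la lb : ℤ}
    (hla : (la : ℝ) ≤ lam2 * ((D : ℤ) : ℝ)) (hlb : lam2 * ((D : ℤ) : ℝ) ≤ (lb : ℝ))
    (hpos : denCellPos L (cosTab L) la lb = true) {S : XBScal} (hS : ScalOK L Δ lam2 f S) (hlam : 0 < lam2)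
    {k1 k2 : ℕ} (hk1 : k1 < L) (hk2 : k2 < L) :
    mem (F2 L f ((((k1 : ℕ) : ZMod L), ((k2 : ℕ) : ZMod L))))
      (fAt L S (gresCellTab L (cosTab L) la lb) (tTab L (gresCellTab L (cosTab L) la lb)) k1 k2) := by
  have hL3 : 3 ≤ L := by omega
  have hF := OuterMaj.f2ClosedPlusTail_holds L hL hΔ0 lam2 f hf hlam
  have mcs := hS.2.1
  have md := hS.2.2.2.2.2.1
  have mnf2 := hS.2.2.2.2.2.2.2.1
  unfold fAt
  by_cases hk : k1 = 0 ∧ k2 = 0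
  · rw [if_pos hk]
    obtain ⟨rfl, rfl⟩ := hk
    have e : ((((0 : ℕ) : ZMod L), (((0 : ℕ) : ZMod L))) : Tor L) = 0 := by ext <;> simp
    rw [e, hF.1]
    exact mnf2
  · rw [if_neg hk]
    have hkne : ((((k1 : ℕ) : ZMod L), ((k2 : ℕ) : ZMod L)) : Tor L) ≠ 0 := by
      rw [Ne, Prod.mk_eq_zero, natCast_zmod_eq_zero L hk1, natCast_zmod_eq_zero L hk2]; exact hk
    rw [hF.2 _ hkne]
    unfold cK
    have h2 := mem_iscale 2 (mem_imul mcs (mem_gAt L hL3 hla hlb hpos hk1 hk2))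
    have h := mem_iadd (mem_ineg (mem_iadd h2 md)) (mem_tAt L hL hΔ0 hf hla hlb hpos hS hk1 hk2 hk)
    have e : -(2 * cS L Δ lam2 f * gres L lam2 ((((k1 : ℕ) : ZMod L), ((k2 : ℕ) : ZMod L))) + dPar L Δ f)
          + tfun L Δ f ((((k1 : ℕ) : ZMod L), ((k2 : ℕ) : ZMod L)))
        = -(((2 : ℕ) : ℝ) * (cS L Δ lam2 f * gres L lam2 ((((k1 : ℕ) : ZMod L), ((k2 : ℕ) : ZMod L)))) + dPar L Δ f)
          + tfun L Δ f ((((k1 : ℕ) : ZMod L), ((k2 : ℕ) : ZMod L))) := by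
      push_cast; ring
    rw [e]; exact h

end FinXB

end Summit.HubbardSuperconductivity.HubbardSuperconductivity.Theorems.AnisotropyChord.Transfer.Fibre3
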